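import Mathlib
import Summits.MatrixMultiplication.MatrixMultiplication.Theorems.SnSubsetDichotomyHyperoctahedralThresholdCleanPairHopCore

/-!
# Clean-pair atom — THE HOP

Helper for crux `SnSubsetDichotomy.HyperoctahedralThreshold` (stmt-MatrixMultiplication-10883), line
`Lines/stub_plan_poorRigidCore.md`, proof plan `work/ATOM_PROOF.md` §4 of the stub-plan prover seat.

* `exists_fiber_card_ge`: pigeonhole.
* `hop`: a totally dirty level hops (after an optional time reversal) to a full-prefix class of a hub's touchers, re-rooted at
  the common rung, with depth consumption `r < t' ≤ d/2` and density gain `≥ 3` (cheap) or `≥ √s₀/(64(a+1)²)` (big).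
-/

-- the tree's namespace `Summit.MatrixMultiplication.MatrixMultiplication.…` repeats a component by design
set_option linter.dupNamespace false

namespace Summit.MatrixMultiplication.MatrixMultiplication.Theorems.HyperoctahedralThreshold

namespace CleanPair

open TwinSupplyCS

variable {n : ℕ}

section Main

variable {μ : Fin 3 → Equiv.Perm (Fin n)} {F : Finset (Fin n)} {r : ℕ}


/-- Elementary pigeonhole: some fibre of a map into `t` carries at least the average. -/
theorem exists_fiber_card_ge {α β : Type*} [DecidableEq β] (s : Finset α) (t : Finset β) (f : α → β)
    (hf : ∀ x ∈ s, f x ∈ t) (ht : t.Nonempty) :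
    ∃ y ∈ t, s.card ≤ t.card * (s.filter fun x => f x = y).card := by
  have hsum : ∑ y ∈ t, s.card = ∑ y ∈ t, t.card * (s.filter fun x => f x = y).card := by
    rw [Finset.sum_const, smul_eq_mul, ← Finset.mul_sum, ← Finset.card_eq_sum_card_fiberwise hf]
  exact Finset.exists_le_of_sum_le ht hsum.le

set_option maxHeartbeats 400000 in
/-- **THE HOP.**  A totally dirty level of depth `d` with `2 ≤ |S|`, `2r + 2 ≤ d ≤ a`, at scale parameters with
`288(a+1)² ≤ 2^(r/2)` and `F ⊇ F_cyc(2r) ∪ F_dense(s₀, 2a)`, hops — after an optional time reversal — to a level of depth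
`d' = d - t'` with `r < t' ≤ d/2` whose density `|S'|/2^d'` is at least `3 ×` (cheap: `2^(t'+1) ≤ 3s₀`) or at least
`√s₀/(64(a+1)²) ×` (big) the old density `|S|/2^d`. -/
theorem hop (hμ : ∀ c, μ c * μ c = 1) (hF : NoShortCycleOutside μ F r) {p : Bool → Fin n} {d : ℕ}
    {S : Finset (List (Fin 3))} (hI : Inv μ F r p d S) {s₀ a : ℕ} (hs₀ : 0 < s₀) (hda : d ≤ a)
    (hdense : ∀ y ∉ F, ∀ m, 1 ≤ m → m ≤ 2 * a → s₀ * (closedAt μ m y).card ≤ 2 ^ m)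
    (hr : 288 * (a + 1) ^ 2 ≤ 2 ^ (r / 2)) (hM : 2 ≤ S.card) :
    ∃ (p' : Bool → Fin n) (d' : ℕ) (S' : Finset (List (Fin 3))),
      Inv μ F r p' d' S' ∧ r < d - d' ∧ d ≤ 2 * d' ∧ d' ≤ d ∧
      ((2 ^ (d - d' + 1) ≤ 3 * s₀ ∧ 3 * S.card * 2 ^ d' ≤ S'.card * 2 ^ d) ∨
        S.card * Nat.sqrt s₀ * 2 ^ d' ≤ S'.card * 2 ^ d * (64 * (a + 1) ^ 2)) := by
  have hI0 := hI
  obtain ⟨hroot, hmem, hcell, hdirty⟩ := hI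
  -- a base strand and its touchers
  obtain ⟨β₁, hβ₁⟩ : S.Nonempty := Finset.card_pos.1 (by omega)
  obtain ⟨hlen₁, hc₁, hA₁, hSep₁⟩ := hmem β₁ hβ₁
  set T := S.erase β₁ with hT
  have hTcard : T.card = S.card - 1 := Finset.card_erase_of_mem hβ₁
  have hdef : ∀ β' ∈ T, ∃ s t : ℕ, ∃ σ σ' : Bool, s ≤ d ∧ t ≤ d ∧
      pos μ p β₁ σ s = pos μ p β' σ' t ∧ pos μ p β₁ (!σ) s ≠ pos μ p β' (!σ') t := by
    intro β' hβ'
    rw [hT, Finset.mem_erase] at hβ'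
    obtain ⟨s, hs, t, ht, σ, σ', h1, h2⟩ := hdirty β₁ hβ₁ β' hβ'.2 (Ne.symm hβ'.1)
    exact ⟨s, t, σ, σ', hs, ht, h1, h2⟩
  choose! fs ft fσ fσ' hspec using hdef
  -- pigeonhole on (s, σ, σ') ∈ range (d+1) × Bool × Bool
  set K := (Finset.range (d + 1)) ×ˢ (Finset.univ : Finset Bool) ×ˢ (Finset.univ : Finset Bool) with hK
  have hKcard : K.card = 4 * (d + 1) := by simp [hK]; ring
  set g : List (Fin 3) → ℕ × Bool × Bool := fun β' => (fs β', fσ β', fσ' β') with hg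
  have hgK : ∀ β' ∈ T, g β' ∈ K := by
    intro β' hβ'
    simp only [hg, hK, Finset.mem_product, Finset.mem_range, Finset.mem_univ, and_true]
    have := (hspec β' hβ').1; omega
  obtain ⟨⟨s₁, σ₁, σ'⟩, _, hfib⟩ := exists_fiber_card_ge T K g hgK ⟨(0, false, false), by simp [hK]⟩
  set f₁ := T.filter fun β' => g β' = (s₁, σ₁, σ') with hf₁
  set u := pos μ p β₁ σ₁ s₁ with hu
  -- every member of the popular fibre reaches u on side σ' at its time ft, strictly inside (r, d - r)
  have hf₁spec : ∀ β' ∈ f₁, β' ∈ S ∧ r < ft β' ∧ ft β' + r < d ∧ ft β' ≤ d ∧ pos μ p β' σ' (ft β') = u := by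
    intro β' hβ'
    rw [hf₁, Finset.mem_filter] at hβ'
    obtain ⟨hβ'T, hgβ'⟩ := hβ'
    simp only [hg, Prod.mk.injEq] at hgβ'
    obtain ⟨e1, e2, e3⟩ := hgβ'
    obtain ⟨hs, ht, h1, h2⟩ := hspec β' hβ'T
    rw [e1, e2, e3] at h1 h2
    have hβ'S : β' ∈ S := (Finset.mem_erase.1 (hT ▸ hβ'T)).2
    exact ⟨hβ'S, toucher_time_gt hμ hF hI0 hβ₁ hβ'S (by omega) ht h1 h2,
      toucher_time_lt hμ hF hI0 hβ₁ hβ'S (by omega) ht h1 h2, ht, h1.symm⟩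
  have hf₁big : S.card - 1 ≤ 4 * (d + 1) * f₁.card := by rw [← hTcard, ← hKcard]; exact hfib
  -- early and late halves
  set early := f₁.filter fun β' => 2 * ft β' ≤ d with hearly
  set late := f₁.filter fun β' => ¬ 2 * ft β' ≤ d with hlate
  have hsplit : early.card + late.card = f₁.card := Finset.card_filter_add_card_filter_not _
  have hr' : 288 * (d + 1) ^ 2 ≤ 2 ^ (r / 2) :=
    le_trans (Nat.mul_le_mul_left _ (Nat.pow_le_pow_left (by omega) 2)) hr
  by_cases hdir : f₁.card ≤ 2 * early.card
  · ---------------------------------------------------------------- forward hop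
    have hsparse : ∀ m, 1 ≤ m → m ≤ 2 * d → s₀ * (closedAt μ m (p σ')).card ≤ 2 ^ m := by
      intro m h1 h2
      have : p σ' ∉ F := by have := hA₁ σ' 0 (by omega); rwa [pos_zero] at this
      exact hdense _ this m h1 (by omega)
    obtain ⟨β', hβ', hgood⟩ := hop_core hμ hI0 hs₀ hsparse hr' early
      (fun β' hβ' => (hf₁spec β' (Finset.mem_filter.1 hβ').1).1) ft
      (fun β' hβ' => by
        obtain ⟨hβ'f, he⟩ := Finset.mem_filter.1 hβ'
        obtain ⟨_, h1, _, _, h3⟩ := hf₁spec β' hβ'f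
        exact ⟨h1, he, h3⟩)
      (le_trans hf₁big (by
        calc 4 * (d + 1) * f₁.card ≤ 4 * (d + 1) * (2 * early.card) := Nat.mul_le_mul_left _ hdir
          _ = 8 * (d + 1) * early.card := by ring)) hM
    obtain ⟨hβ'f, hearlyβ'⟩ := Finset.mem_filter.1 hβ'
    obtain ⟨hβ'S, hrt, _, htd, _⟩ := hf₁spec β' hβ'f
    set t' := ft β' with ht'
    refine ⟨fun τ => pos μ p β' τ t', d - t', (S.filter fun β => β.take t' = β'.take t').image fun β => β.drop t',
      inv_drop hμ hF hI0 (β'.take t') (by omega) β' rfl, by omega, by omega, by omega, ?_⟩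
    rw [card_image_drop]
    have e2 : 2 ^ d = 2 ^ t' * 2 ^ (d - t') := by rw [← pow_add]; congr 1; omega
    rcases hgood with ⟨hc1, hc2⟩ | hb
    · left
      refine ⟨by rw [show d - (d - t') = t' by omega]; exact hc1, ?_⟩
      calc 3 * S.card * 2 ^ (d - t') ≤ (S.filter fun β => β.take t' = β'.take t').card * 2 ^ t' * 2 ^ (d - t') :=
            Nat.mul_le_mul_right _ hc2
        _ = _ := by rw [e2]; ring
    · right
      calc S.card * Nat.sqrt s₀ * 2 ^ (d - t')
          ≤ (S.filter fun β => β.take t' = β'.take t').card * 2 ^ t' * (64 * (d + 1) ^ 2) * 2 ^ (d - t') :=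
            Nat.mul_le_mul_right _ hb
        _ ≤ (S.filter fun β => β.take t' = β'.take t').card * 2 ^ t' * (64 * (a + 1) ^ 2) * 2 ^ (d - t') := by
            gcongr
        _ = _ := by rw [e2]; ring
  · ---------------------------------------------------------------- reversed hop
    push Not at hdir
    have hlate2 : f₁.card ≤ 2 * late.card := by omega
    have hIr := inv_reverse hμ hI0 β₁ hβ₁
    set pr : Bool → Fin n := fun τ => pos μ p β₁ τ d with hpr
    -- positions of reversed strands
    have hposr : ∀ β ∈ S, ∀ τ, ∀ v ≤ d, pos μ pr β.reverse τ v = pos μ p β τ (d - v) := by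
      intro β hβ τ v _
      have hlen : β.length = d := (hmem β hβ).1
      have e : pr = fun τ => pos μ p β τ β.length := by
        funext τ'; rw [hlen]; exact (hcell β hβ β₁ hβ₁ τ').symm
      rw [e, pos_reverse μ hμ p β τ v, hlen]
    have hsparse : ∀ m, 1 ≤ m → m ≤ 2 * d → s₀ * (closedAt μ m (pr σ')).card ≤ 2 ^ m := by
      intro m h1 h2
      have : pr σ' ∉ F := hA₁ σ' d (by omega)
      exact hdense _ this m h1 (by omega)
    have hcardr : (S.image List.reverse).card = S.card := card_image_reverse S
    obtain ⟨γ', hγ', hgood⟩ := hop_core hμ hIr hs₀ hsparse hr' (late.image List.reverse)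
      (by
        intro γ hγ
        rw [Finset.mem_image] at hγ
        obtain ⟨β', hβ', rfl⟩ := hγ
        exact Finset.mem_image_of_mem _ (hf₁spec β' (Finset.mem_filter.1 hβ').1).1)
      (fun γ => d - ft γ.reverse)
      (by
        intro γ hγ
        rw [Finset.mem_image] at hγ
        obtain ⟨β', hβ', rfl⟩ := hγ
        obtain ⟨hβ'f, hl⟩ := Finset.mem_filter.1 hβ'
        obtain ⟨hβ'S, h1, h2, h4, h3⟩ := hf₁spec β' hβ'f
        simp only [List.reverse_reverse]
        refine ⟨by omega, by omega, ?_⟩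
        rw [hposr β' hβ'S σ' (d - ft β') (by omega), Nat.sub_sub_self h4]
        exact h3)
      (by
        rw [hcardr, Finset.card_image_of_injective _ List.reverse_injective]
        exact le_trans hf₁big (by
          calc 4 * (d + 1) * f₁.card ≤ 4 * (d + 1) * (2 * late.card) := Nat.mul_le_mul_left _ hlate2
            _ = 8 * (d + 1) * late.card := by ring))
      (by rw [hcardr]; exact hM)
    rw [Finset.mem_image] at hγ'
    obtain ⟨β', hβ'l, rfl⟩ := hγ'
    obtain ⟨hβ'f, hlateβ'⟩ := Finset.mem_filter.1 hβ'l
    obtain ⟨hβ'S, hrt, htr, htd, _⟩ := hf₁spec β' hβ'f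
    simp only [List.reverse_reverse] at hgood
    rw [hcardr] at hgood
    obtain ⟨t', ht'⟩ : ∃ t', t' = d - ft β' := ⟨_, rfl⟩
    rw [← ht'] at hgood
    refine ⟨fun τ => pos μ pr β'.reverse τ t', d - t',
      ((S.image List.reverse).filter fun β => β.take t' = β'.reverse.take t').image fun β => β.drop t',
      inv_drop hμ hF hIr (β'.reverse.take t') (by omega) β'.reverse rfl, by omega, by omega, by omega, ?_⟩
    rw [card_image_drop]
    have e2 : 2 ^ d = 2 ^ t' * 2 ^ (d - t') := by rw [← pow_add]; congr 1; omega
    rcases hgood with ⟨hc1, hc2⟩ | hb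
    · left
      refine ⟨by rw [show d - (d - t') = t' by omega]; exact hc1, ?_⟩
      calc 3 * S.card * 2 ^ (d - t')
          ≤ ((S.image List.reverse).filter fun β => β.take t' = β'.reverse.take t').card * 2 ^ t' * 2 ^ (d - t') :=
            Nat.mul_le_mul_right _ hc2
        _ = _ := by rw [e2]; ring
    · right
      calc S.card * Nat.sqrt s₀ * 2 ^ (d - t')
          ≤ ((S.image List.reverse).filter fun β => β.take t' = β'.reverse.take t').card * 2 ^ t' *
              (64 * (d + 1) ^ 2) * 2 ^ (d - t') := Nat.mul_le_mul_right _ hb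
        _ ≤ ((S.image List.reverse).filter fun β => β.take t' = β'.reverse.take t').card * 2 ^ t' *
              (64 * (a + 1) ^ 2) * 2 ^ (d - t') := by gcongr
        _ = _ := by rw [e2]; ring


end Main

end CleanPair

open CleanPair in
/-- **`stub_hop`** (registered sub-goal of stmt-MatrixMultiplication-10883): THE HOP of the depth recursion (ATOM_PROOF §4), in the
landed `CleanPair` vocabulary. -/
theorem stub_hop : ∀ (n r d s₀ a : ℕ) (μ : Fin 3 → Equiv.Perm (Fin n)) (F : Finset (Fin n)) (p : Bool → Fin n) (S : Finset (List (Fin 3))), (∀ c, μ c * μ c = 1) → Summit.MatrixMultiplication.MatrixMultiplication.Theorems.HyperoctahedralThreshold.CleanPair.NoShortCycleOutside μ F r → Summit.MatrixMultiplication.MatrixMultiplication.Theorems.HyperoctahedralThreshold.CleanPair.Inv μ F r p d S → 0 < s₀ → d ≤ a → (∀ y ∉ F, ∀ m, 1 ≤ m → m ≤ 2 * a → s₀ * (Summit.MatrixMultiplication.MatrixMultiplication.Theorems.HyperoctahedralThreshold.TwinSupplyCS.closedAt μ m y).card ≤ 2 ^ m) → 288 * (a + 1) ^ 2 ≤ 2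 ^ (r / 2) → 2 ≤ S.card → ∃ (p' : Bool → Fin n) (d' : ℕ) (S' : Finset (List (Fin 3))), Summit.MatrixMultiplication.MatrixMultiplication.Theorems.HyperoctahedralThreshold.CleanPair.Inv μ F r p' d' S' ∧ r < d - d' ∧ d ≤ 2 * d' ∧ d' ≤ d ∧ ((2 ^ (d - d' + 1) ≤ 3 * s₀ ∧ 3 * S.card * 2 ^ d' ≤ S'.card * 2 ^ d) ∨ S.card * Nat.sqrt s₀ * 2 ^ d' ≤ S'.card * 2 ^ d * (64 * (a + 1) ^ 2)) :=
  fun _ _ _ _ _ _ _ _ _ hμ hF hI hs₀ hda hdense hr hM => hop hμ hF hI hs₀ hda hdense hr hM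

end Summit.MatrixMultiplication.MatrixMultiplication.Theorems.HyperoctahedralThreshold
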